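import Summits.ResolutionOfSingularities.ResolutionOfSingularities.Theorems.MarkedTransferCampaignW46TameCalculusStatement
import Summits.ResolutionOfSingularities.ResolutionOfSingularities.Theorems.MarkedTransferCampaignW46TameRidgeIdeal
import Summits.ResolutionOfSingularities.ResolutionOfSingularities.Theorems.MarkedTransferCampaignW46TameRegime
import HarnessLib

/-!
# [OURS · L1 W4.6, rung (iv) «large characteristic», gen 2] PROOFS BY NAME of the statement file
# `MarkedTransferCampaignW46TameCalculusStatement` (res-L1-type-o1, statement-only lane): items (C)–(G) of the slot W4.6
# rung (iv) campaign are closed at every value of their parameters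
# (cell res-hironaka, LADDER-RESOLUTION rung L, D-0089; seat res-L1-s46-pv-7; host route MarkedTransfer,
# `--supports stmt-ResolutionOfSingularities-16155 --as helper`)

HONEST FRAMING. Nothing here is a statement of H. Hironaka's manuscript (2017-03-23, [Hironaka2017]) and nothing here
asserts that any statement of it holds; the five OURS predicates are campaign statements over the tree's directrix /
ridge vocabulary and the OURS typed-procedure module, and each is closed by a kernel theorem landed earlier by this seat
(`TamePolar` p481074, `TameRidgeFunctor` p485759, `TameRidgeIdeal` p486683, `TameRegime` p483854). No premise of the
manuscript, no FACT-LIST premise. AI review is weaker than expert review. No `sorry`, no definition; axioms standard.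

| item | predicate (statement file) | closer (this file) | kernel theorem |
|---|---|---|---|
| (C) | `CampaignW46TameDirectrixFirstOrder p K d` | `campaignW46TameDirectrixFirstOrder_holds` / `_all` | `TamePolar.invarianceSpace_singleton_eq_ker_polar_of_totalDegree_lt_char` |
| (D) | `CampaignW46TameRidgePolarKernel p K n` | `campaignW46TameRidgePolarKernel_holds` / `_all` | `TameRidgeFunctor.mem_ridge_span_singleton_iff_polar_eq_zero_of_lt_char` |
| (E) | `CampaignW46TameRidgeIdealLinear p K n` | `campaignW46TameRidgeIdealLinear_holds` / `_all` | `TameRidgeIdeal.ridgeIdeal_span_singleton_eq_span_linearHasse_of_lt_char` |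
| (F) | `CampaignW46TameRegimeTauFirstOrder p K n` | `campaignW46TameRegimeTauFirstOrder_holds` / `_all` | `TameRegime.hironakaTauAt_stalk_add_finrank_iInf_ker_polar` |
| (G) | `CampaignW46DirectrixNotFirstOrderAtCharDegree p K d` | `campaignW46DirectrixNotFirstOrderAtCharDegree_holds` / `_all` | `TamePolar.hironakaTau_X_pow_char_ne_finrank_span_pderiv` |

Release lines for res-L1-s46-plan-1 (once the items are registered at rank 9 on route MarkedTransfer): each item
`∀ p [Fact p.Prime] K [Field K] [CharP K p] d, CampaignW46…` is closed `--by
Summit.ResolutionOfSingularities.ResolutionOfSingularities.Theorems.campaignW46…_all`.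
-/

noncomputable section

set_option linter.dupNamespace false -- mandated namespace of this single-conjunct summit

namespace Summit.ResolutionOfSingularities.ResolutionOfSingularities.Theorems

universe u

/-- [OURS · L1 W4.6 (iv) (C); NOT a statement of the manuscript] **Item (C) holds**: the tame directrix is first-order,
at every `(p, K, d)`. [folklore] -/
theorem campaignW46TameDirectrixFirstOrder_holds (p : ℕ) [Fact p.Prime] (K : Type u) [Field K] [CharP K p] (d : ℕ) :
    CampaignW46TameDirectrixFirstOrder p K d := by
  intro F hF
  exact CampaignW46.TamePolar.invarianceSpace_singleton_eq_ker_polar_of_totalDegree_lt_char K p F hF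

/-- [OURS · L1 W4.6 (iv) (C)] Item (C) in closed `∀` form. [folklore] -/
theorem campaignW46TameDirectrixFirstOrder_all :
    ∀ (p : ℕ) [Fact p.Prime] (K : Type u) [Field K] [CharP K p] (d : ℕ), CampaignW46TameDirectrixFirstOrder p K d :=
  fun p _ K _ _ d => campaignW46TameDirectrixFirstOrder_holds p K d

/-- [OURS · L1 W4.6 (iv) (D); NOT a statement of the manuscript] **Item (D) holds**: the tame ridge is the polar kernel on
every commutative `K`-algebra, at every `(p, K, n)`. [folklore] -/
theorem campaignW46TameRidgePolarKernel_holds (p : ℕ) [Fact p.Prime] (K : Type u) [Field K] [CharP K p] (n : ℕ) :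
    CampaignW46TameRidgePolarKernel p K n := by
  intro F b hF hb k' _ _ v
  exact CampaignW46.TameRidgeFunctor.mem_ridge_span_singleton_iff_polar_eq_zero_of_lt_char p hF hb v

/-- [OURS · L1 W4.6 (iv) (D)] Item (D) in closed `∀` form. [folklore] -/
theorem campaignW46TameRidgePolarKernel_all :
    ∀ (p : ℕ) [Fact p.Prime] (K : Type u) [Field K] [CharP K p] (n : ℕ), CampaignW46TameRidgePolarKernel p K n :=
  fun p _ K _ _ n => campaignW46TameRidgePolarKernel_holds p K n

/-- [OURS · L1 W4.6 (iv) (E); NOT a statement of the manuscript] **Item (E) holds**: in tame degree the ridge ideal is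
generated by the linear Hasse–Schmidt derivatives, at every `(p, K, n)`. [folklore] -/
theorem campaignW46TameRidgeIdealLinear_holds (p : ℕ) [Fact p.Prime] (K : Type u) [Field K] [CharP K p] (n : ℕ) :
    CampaignW46TameRidgeIdealLinear p K n := by
  intro F b hF hb
  exact CampaignW46.TameRidgeIdeal.ridgeIdeal_span_singleton_eq_span_linearHasse_of_lt_char p hF hb

/-- [OURS · L1 W4.6 (iv) (E)] Item (E) in closed `∀` form. [folklore] -/
theorem campaignW46TameRidgeIdealLinear_all :
    ∀ (p : ℕ) [Fact p.Prime] (K : Type u) [Field K] [CharP K p] (n : ℕ), CampaignW46TameRidgeIdealLinear p K n :=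
  fun p _ K _ _ n => campaignW46TameRidgeIdealLinear_holds p K n

/-- [OURS · L1 W4.6 (iv) (F); NOT a statement of the manuscript] **Item (F) holds**: in regime (iv)
(`Regime.charGT n (fun _ b ↦ b)`) `τ` is first-order at every point of every state, at every `(p, K, n)`. [folklore] -/
theorem campaignW46TameRegimeTauFirstOrder_holds (p : ℕ) [Fact p.Prime] (K : Type u) [Field K] [CharP K p] (n : ℕ) :
    CampaignW46TameRegimeTauFirstOrder p K n := by
  intro A E hE ξ hp d c
  exact CampaignW46.TameRegime.hironakaTauAt_stalk_add_finrank_iInf_ker_polar A E hE ξ hp c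

/-- [OURS · L1 W4.6 (iv) (F)] Item (F) in closed `∀` form. [folklore] -/
theorem campaignW46TameRegimeTauFirstOrder_all :
    ∀ (p : ℕ) [Fact p.Prime] (K : Type u) [Field K] [CharP K p] (n : ℕ), CampaignW46TameRegimeTauFirstOrder p K n :=
  fun p _ K _ _ n => campaignW46TameRegimeTauFirstOrder_holds p K n

/-- [OURS · L1 W4.6 (iv) (G); NOT a statement of the manuscript] **Item (G) holds** (honest-failure side): at degree
`p = char K` Hironaka's `τ` of `Y_0^p` is NOT the polar rank, at every `(p, K, d)`. [folklore] -/
theorem campaignW46DirectrixNotFirstOrderAtCharDegree_holds (p : ℕ) [Fact p.Prime] (K : Type u) [Field K] [CharP K p]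
    (d : ℕ) : CampaignW46DirectrixNotFirstOrderAtCharDegree p K d :=
  CampaignW46.TamePolar.hironakaTau_X_pow_char_ne_finrank_span_pderiv K p

/-- [OURS · L1 W4.6 (iv) (G)] Item (G) in closed `∀` form. [folklore] -/
theorem campaignW46DirectrixNotFirstOrderAtCharDegree_all :
    ∀ (p : ℕ) [Fact p.Prime] (K : Type u) [Field K] [CharP K p] (d : ℕ),
      CampaignW46DirectrixNotFirstOrderAtCharDegree p K d :=
  fun p _ K _ _ d => campaignW46DirectrixNotFirstOrderAtCharDegree_holds p K d

end Summit.ResolutionOfSingularities.ResolutionOfSingularities.Theorems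

end
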